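import Summits.QuantumFields.YangMills.Theorems.BalabanUVNodesN15NE2PlusOperatorM1
import HarnessLib

/-!
# THE COARSE REPRESENTATIVE AS A LOCATED INPUT: the gauge-dressed family over PAIRS `(A′, B)` (ANY coarse field `B` within the comparison letters of [B9] (3.35)–(3.36)),
# `NE2PlusOperatorM1` for it hypothesis-free; the linearised block mean (model-level item (C3) of FILES 30∕39) becomes ONE admissible choice (dag-n15-c g10, FILE 42; N15 = NE2, s1)

`--kind definition --supports stmt-QuantumFields-20544 --as helper` (K3⁷; count-neutral).  Imports BY NAME this seat's FILE 39 `…NE2PlusOperatorM1` (`NE2PlusOperatorM1`, ★★★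
`ne2PlusOperatorM1_twoSided_of_letters`; through it FILE 30 `v1cfgFX`, FILE 29b ★★ `twoSidedLettersX_of_gauge`, FILE 27 `fgInstanceV1G` ∕ ★★ `uniform_layer_fullGM₂R`, FILE 26
`gaugeLetters_of_mean`, FILE 24 `bgInstanceM₂R` ∕ `bgFamilyM₂R` ∕ `TwoSidedLetters`, g3 `v1GaugeBg` ∕ `v1GaugePairing`); nothing in the tree is modified.

WHY∕WHAT.  In FILES 30∕35∕38∕39 the coarse coefficients are read from the LINEARISED block mean `Ā = gavgM π A′` — model-level item (C3) (Bałaban's averaging (3.36)∕[15] is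
nonlinear).  The estimates never use `B = Ā`, only five COMPARISON LETTERS between `A′` and `B` (FILE 29b ★★ `twoSidedLettersX_of_gauge`).  Here the coarse representative is an
INPUT: §1 `v1GaugeBgPair` (configurations `U = (A′, B)`; `Reg335 c α₀ U` = the C² letters of `A′` at `r = cMα₀` AND the five comparison letters of `B` at `(Cr, η)`;
`reg335_v1GaugeBgPair_iff`), `v1GaugePairingP` (g3's pairing with `avg := Prod.snd`), `fgInstanceV1GP`, `fgFamilyV1XP` (readings `v1cfgFX … U.1` ∕ `v1cfgFX … U.2`),
`fgInstanceV1GP_gf_M`; §2 ★★ `twoSidedLettersXP_torus`; §3 ★★★ `ne2PlusOperatorM1_fullGM₂_v1XP_of_entry2`, ★★★ **`ne2PlusOperatorM1_fullGM₂_v1XP : NE2PlusOperatorM1 c₃₅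
(fgInstanceV1GP d 𝔄 ι hL C) (fgFamilyV1XP d 𝔄 ι e hL C b)`** (every `C ≥ 0`, hypothesis-free — for EVERY admissible coarse representative, the nonlinear average included AS SOON AS
it is shown admissible, not done here), `ne2PlusOperator_fullGM₂_v1XP`, `_dim4`; §4 ★ `reg335_pair_of_mean` (the linear mean IS admissible, `C = 2(d+2)`) and `fgFamilyV1XP_e_mean`
(the pair family at `(A′, Ā)` reads FILE 30's family at `A′`, `rfl`), `ne2PlusOperatorM1_fullGM₂_v1X_of_pair` (the pair theorem at `C = 2(d+2)` gives back FILE 39's, `c₃₅ ≥ 0`).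

HONEST FRAMING.  (C3) is now a LOCATED HYPOTHESIS on the configuration (the comparison letters), not discharged for Bałaban's nonlinear average; the other model-level items are as in
FILE 39 (flat base point `U ≡ 1` of the dressing, `DRD*` ∕ `aQ*Q` at `U ≡ 1`, C² reading of (3.35)–(3.36) in one global gauge, `𝔤 ↦ 𝔄` with coordinates).  No new estimate (29b's
letters + FILE 39's socket).  NE2⁺ as printed NOT PRINTED; count-neutral; N15 NOT discharged; one finite torus at fixed ε — NOT ℝ⁴, NOT infinite volume, NOT OS, NOT a mass gap, NOT Clay.
-/

noncomputable section

namespace Summit.QuantumFields.YangMills.BalabanUVNodes.N15.BackgroundLayer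

open Literature.MathematicalPhysics.QuantumFieldTheory.Balaban1983to89
open Literature.MathematicalPhysics.QuantumFieldTheory.Balaban1983to89.B11SectG (BlockNorm HasMaj RowSum hasMaj_comp hasMaj_comp_exp hasMaj_zero)
open Literature.MathematicalPhysics.QuantumFieldTheory.Balaban1983to89.T4EtaRate (PairedInstance EtaPairing EtaRateIneq342 NE2PlusOperator rateFactor)
open Literature.MathematicalPhysics.QuantumFieldTheory.Balaban1983to89.T4EtaRateDefect (idef idef_apply idef_comp idef_zero rateWeight)
open Literature.MathematicalPhysics.QuantumFieldTheory.Balaban1983to89.T4EtaRateCoeffDefect (pull pull_apply diagK diagK_nonneg)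
open Literature.MathematicalPhysics.QuantumFieldTheory.Balaban1983to89.B6RandomWalk (Triangle254)
open Summit.QuantumFields.YangMills.BalabanUVNodes.N15.OperatorReadout (opGeo opFamily opGeo_len rateFactor_opGeo etaRateIneq342_of_hasMaj_rateWeight)
open Summit.QuantumFields.YangMills.BalabanUVNodes.N15.MatrixSpecies (mmulOp liftEquiv liftMap liftBlk liftEquiv_apply liftEquiv_symm_apply basisConst basisConst_nonneg)
open Summit.QuantumFields.YangMills.BalabanUVNodes.N15.SiteLayer (hasMaj_exp_comp_diagK hasMaj_diagK_comp_exp hasMaj_add_exp hasMaj_exp_mono)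
open Literature.MathematicalPhysics.QuantumFieldTheory.Balaban1983to89.B5Prop11Plancherel (Tor fine unitVec)
open Literature.MathematicalPhysics.QuantumFieldTheory.Balaban1983to89.B5SiteBridgeP12 (MP)
open Literature.MathematicalPhysics.QuantumFieldTheory.Balaban1983to89.B6UnitTorusCarrier (unitTorusGeo triangle254_unitTorusGeo rowSum_unitTorusGeo unitTorusGeo_dist_nonneg unitTorusGeo_len)
open Literature.MathematicalPhysics.QuantumFieldTheory.King1986.Torus (blockOf tdistT tdistT_nonneg tdistT_self)
open Summit.QuantumFields.YangMills.BalabanUVNodes.N15.TwoGrid (gOp symbOp sT sTinv sD sLap paramsOf hasMaj_rate_mono hasMaj_twoGridDefect_div TGIndex TGIndex.Mn)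
open Summit.QuantumFields.YangMills.BalabanUVNodes.N15.VectorPiece (blkFine kingPrV blkFine_comp_kingPrV bshiftEquiv bshiftEquiv_apply bshiftEquiv_symm_apply bshiftV bshiftV_apply tensorId tensorId_apply hasMaj_tensorId idef_tensorId kingPrV_bshiftEquiv_pow fibre_conn_kingPrV bshiftEquiv_comm inv_pow_le_rpow)

variable {d : ℕ} {L : ℕ} [NeZero L]

/-! ## §1 The pair carrier, its pairing, the instance and the family -/

section Pair

variable (𝔄 : Type) [NormedRing 𝔄] [NormedAlgebra ℝ 𝔄] {X X' : Type} (J : Type) [Fintype J]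

/-- **THE PAIR REGULARITY WINDOW** `pairReg335 … c α₀ (A′, B)`: the unit-scale C² letters (3.35) of the fine field `A′` at `r = cMα₀` (spacing `η′`; as g3 `v1GaugeBg`) AND the five
comparison letters of the COARSE REPRESENTATIVE `B` at `(C·r, η)` (blocks `π`): `‖B‖ ≤ Cr`, `‖B − B∘s_μ⁻¹‖ ≤ Crη`, `‖A′ − B∘π‖ ≤ Crη`, `‖A′∘s′_μ⁻¹ − B∘s_μ⁻¹∘π‖ ≤ Crη`,
`‖η′⁻¹(A′ − A′∘s′_μ⁻¹) − η⁻¹(B − B∘s_μ⁻¹)∘π‖ ≤ Crη` — what an averaging operation must deliver. [cite: Balaban1985BackgroundPropagators, (3.35)–(3.36) p.396 (shapes)] -/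
def pairReg335 (π : X' → X) (s : J → X ≃ X) (s' : J → X' ≃ X') (η η' M C c α₀ : ℝ) (U : (J → X' → 𝔄) × (J → X → 𝔄)) : Prop :=
  ((∀ μ x', ‖U.1 μ x'‖ ≤ c * M * α₀) ∧ (∀ μ κ x', ‖U.1 μ (s' κ x') - U.1 μ x'‖ ≤ c * M * α₀ * η') ∧
      (∀ μ κ x', ‖(U.1 μ (s' κ x') - U.1 μ x') - (U.1 μ (s' κ ((s' μ).symm x')) - U.1 μ ((s' μ).symm x'))‖ ≤ c * M * α₀ * η' * η')) ∧
    ((∀ μ x, ‖U.2 μ x‖ ≤ C * (c * M * α₀)) ∧ (∀ μ x, ‖U.2 μ x - U.2 μ ((s μ).symm x)‖ ≤ C * (c * M * α₀) * η) ∧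
      (∀ μ x', ‖U.1 μ x' - U.2 μ (π x')‖ ≤ C * (c * M * α₀) * η) ∧ (∀ μ x', ‖U.1 μ ((s' μ).symm x') - U.2 μ ((s μ).symm (π x'))‖ ≤ C * (c * M * α₀) * η) ∧
      (∀ μ x', ‖η'⁻¹ • (U.1 μ x' - U.1 μ ((s' μ).symm x')) - η⁻¹ • (U.2 μ (π x') - U.2 μ ((s μ).symm (π x')))‖ ≤ C * (c * M * α₀) * η))

/-- **THE PAIR CARRIER**: configurations `U = (A′, B)`, `one := 0`, `mul := (+)`, `Reg335 := pairReg335` (and `Reg336` repeats it, as g3's `v1GaugeBg`); (3.37)–(3.38) inert.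
[cite: Balaban1985BackgroundPropagators, (3.35)–(3.36) p.396 (shapes: regularity of the fine configuration and of the averaged one)] -/
def v1GaugeBgPair (π : X' → X) (s : J → X ≃ X) (s' : J → X' ≃ X') (η η' M C : ℝ) : B9.Backgrounds where
  Cfg := (J → X' → 𝔄) × (J → X → 𝔄)
  one := 0
  mul := fun U₁ U₂ => U₁ + U₂
  Reg335 := pairReg335 𝔄 J π s s' η η' M C
  Reg336 := pairReg335 𝔄 J π s s' η η' M C
  Cplx337 := fun _ _ _ => True
  Cplx338 := fun _ _ _ => True

omit [Fintype J] in
/-- Unfolding of the pair carrier's (3.35): the fine field's letters are g3's `v1GaugeBg … η′ M` letters, the coarse representative's are the five comparison letters. [folklore] -/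
theorem reg335_v1GaugeBgPair_iff (π : X' → X) (s : J → X ≃ X) (s' : J → X' ≃ X') (η η' M C c α₀ : ℝ) (U : (J → X' → 𝔄) × (J → X → 𝔄)) :
    (v1GaugeBgPair 𝔄 J π s s' η η' M C).Reg335 c α₀ U ↔
      (v1GaugeBg 𝔄 J s' η' M).Reg335 c α₀ U.1 ∧
      ((∀ μ x, ‖U.2 μ x‖ ≤ C * (c * M * α₀)) ∧ (∀ μ x, ‖U.2 μ x - U.2 μ ((s μ).symm x)‖ ≤ C * (c * M * α₀) * η) ∧
        (∀ μ x', ‖U.1 μ x' - U.2 μ (π x')‖ ≤ C * (c * M * α₀) * η) ∧ (∀ μ x', ‖U.1 μ ((s' μ).symm x') - U.2 μ ((s μ).symm (π x'))‖ ≤ C * (c * M * α₀) * η) ∧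
        (∀ μ x', ‖η'⁻¹ • (U.1 μ x' - U.1 μ ((s' μ).symm x')) - η⁻¹ • (U.2 μ (π x') - U.2 μ ((s μ).symm (π x')))‖ ≤ C * (c * M * α₀) * η)) :=
  Iff.rfl

variable [Fintype X] [Fintype X'] [DecidableEq X] [DecidableEq X'] [DecidableEq J] {g : B6.Geometry} (ι : Type) [Fintype ι]

/-- THE η-PAIRING OVER THE PAIR CARRIER: g3's `v1GaugePairing` VERBATIM in every geometric field, with the averaging map the PROJECTION `(A′, B) ↦ B` (the coarse representative is
part of the datum). [cite: King1986, p.664 (convention before Prop. 3.8)] -/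
def v1GaugePairingP (blk : X → g.Site) (π : X' → X) (s : J → X ≃ X) (s' : J → X' ≃ X') (n : ℕ) (hL : g.L ≠ 0) (C : ℝ) :
    EtaPairing (opGeo g (X × ι) (liftBlk blk ι)) (fineGeo g (X' × ι) (liftBlk (blk ∘ π) ι) n) (v1GaugeBg 𝔄 J s g.eta g.M)
      (v1GaugeBgPair 𝔄 J π s s' g.eta (g.eta * (g.L ^ n)⁻¹) g.M C) where
  n := n
  k_eq := (v1GaugePairing 𝔄 J ι blk π s s' n hL).k_eq
  L_eq := (v1GaugePairing 𝔄 J ι blk π s s' n hL).L_eq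
  M_eq := (v1GaugePairing 𝔄 J ι blk π s s' n hL).M_eq
  eta_eq := (v1GaugePairing 𝔄 J ι blk π s s' n hL).eta_eq
  ι := (v1GaugePairing 𝔄 J ι blk π s s' n hL).ι
  scale_ι := (v1GaugePairing 𝔄 J ι blk π s s' n hL).scale_ι
  dist_ι := (v1GaugePairing 𝔄 J ι blk π s s' n hL).dist_ι
  τ := (v1GaugePairing 𝔄 J ι blk π s s' n hL).τ
  suppIn_τ := (v1GaugePairing 𝔄 J ι blk π s s' n hL).suppIn_τ
  supNorm_τ := (v1GaugePairing 𝔄 J ι blk π s s' n hL).supNorm_τ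
  avg := Prod.snd
  avg_one := rfl

end Pair

section Family

variable (d) (𝔄 : Type) [NormedRing 𝔄] [NormedAlgebra ℝ 𝔄] [CompleteSpace 𝔄] (ι : Type) [Fintype ι] [DecidableEq ι] (e : 𝔄 ≃L[ℝ] (ι → ℝ))

/-- THE REALISED PAIRED INSTANCE OVER THE PAIR CARRIER at `(i, ν)` (FILE 27's `fgInstanceV1G` with the pair carrier and `v1GaugePairingP`). [cite: Balaban1985BackgroundPropagators, Thm 3.14 pp.426–427 (typing template)] -/
def fgInstanceV1GP (hL : Odd L ∧ 1 < L) (C : ℝ) (i : TGIndex × Fin (d + 1)) : PairedInstance :=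
  bgInstanceM₂R (ι := ι) (g := (unitTorusGeo L i.1.k (TGIndex.Mn d hL i.1))) (blkFine L i.1.k (TGIndex.Mn d hL i.1)) (kingPrV L i.1.k i.1.m (TGIndex.Mn d hL i.1)) i.1.m
    (v1GaugeBg 𝔄 (Fin (d + 1)) (fun μ => bshiftEquiv (TGIndex.Mn d hL i.1) (L ^ i.1.k) μ) (unitTorusGeo L i.1.k (TGIndex.Mn d hL i.1)).eta (unitTorusGeo L i.1.k (TGIndex.Mn d hL i.1)).M)
    (v1GaugeBgPair 𝔄 (Fin (d + 1)) (kingPrV L i.1.k i.1.m (TGIndex.Mn d hL i.1)) (fun μ => bshiftEquiv (TGIndex.Mn d hL i.1) (L ^ i.1.k) μ) (fun μ => bshiftEquiv (TGIndex.Mn d hL i.1) (L ^ i.1.m * L ^ i.1.k) μ) (unitTorusGeo L i.1.k (TGIndex.Mn d hL i.1)).eta ((unitTorusGeo L i.1.k (TGIndex.Mn d hL i.1)).eta * ((unitTorusGeo L i.1.k (TGIndex.Mn d hL i.1)).L ^ i.1.m)⁻¹) (unitTorusGeo L i.1.k (TGIndex.Mn d hL i.1)).M C)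
    (v1GaugePairingP 𝔄 (Fin (d + 1)) ι (g := (unitTorusGeo L i.1.k (TGIndex.Mn d hL i.1))) (blkFine L i.1.k (TGIndex.Mn d hL i.1)) (kingPrV L i.1.k i.1.m (TGIndex.Mn d hL i.1)) (fun μ => bshiftEquiv (TGIndex.Mn d hL i.1) (L ^ i.1.k) μ) (fun μ => bshiftEquiv (TGIndex.Mn d hL i.1) (L ^ i.1.m * L ^ i.1.k) μ) i.1.m (Nat.cast_ne_zero.mpr (NeZero.ne L)) C)

omit [CompleteSpace 𝔄] [DecidableEq ι] in
/-- The fine geometry's size field is the inert `1` of the unit-torus carrier (the `M ≡ 1` class; the guard-free shape `NE2PlusOperatorM1` is the content). [folklore] -/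
theorem fgInstanceV1GP_gf_M (hL : Odd L ∧ 1 < L) (C : ℝ) (i : TGIndex × Fin (d + 1)) : (fgInstanceV1GP d 𝔄 ι hL C i).gf.M = 1 := rfl

/-- THE TWO-SIDED FAMILY OVER THE PAIR CARRIER: FILE 24's `bgFamilyM₂R` with the EXACT readings `v1cfgFX` of the fine field `U.1` (spacing `η′`) and of the coarse representative `U.2`
(spacing `η`), pieces as FILE 30's `fgFamilyV1X`. [cite: Balaban1985BackgroundPropagators, (3.42) p.397 + (3.52) p.400 (shapes)] -/
def fgFamilyV1XP (hL : Odd L ∧ 1 < L) (C b : ℝ) (i : TGIndex × Fin (d + 1)) : B9.KernelFamily (fgInstanceV1GP d 𝔄 ι hL C i).gc (fgInstanceV1GP d 𝔄 ι hL C i).Bf :=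
  bgFamilyM₂R (ι := ι) (g := (unitTorusGeo L i.1.k (TGIndex.Mn d hL i.1))) (blkFine L i.1.k (TGIndex.Mn d hL i.1)) (kingPrV L i.1.k i.1.m (TGIndex.Mn d hL i.1)) i.1.m
    (v1GaugeBg 𝔄 (Fin (d + 1)) (fun μ => bshiftEquiv (TGIndex.Mn d hL i.1) (L ^ i.1.k) μ) (unitTorusGeo L i.1.k (TGIndex.Mn d hL i.1)).eta (unitTorusGeo L i.1.k (TGIndex.Mn d hL i.1)).M)
    (v1GaugeBgPair 𝔄 (Fin (d + 1)) (kingPrV L i.1.k i.1.m (TGIndex.Mn d hL i.1)) (fun μ => bshiftEquiv (TGIndex.Mn d hL i.1) (L ^ i.1.k) μ) (fun μ => bshiftEquiv (TGIndex.Mn d hL i.1) (L ^ i.1.m * L ^ i.1.k) μ) (unitTorusGeo L i.1.k (TGIndex.Mn d hL i.1)).eta ((unitTorusGeo L i.1.k (TGIndex.Mn d hL i.1)).eta * ((unitTorusGeo L i.1.k (TGIndex.Mn d hL i.1)).L ^ i.1.m)⁻¹) (unitTorusGeo L i.1.k (TGIndex.Mn d hL i.1)).M C)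
    (v1GaugePairingP 𝔄 (Fin (d + 1)) ι (g := (unitTorusGeo L i.1.k (TGIndex.Mn d hL i.1))) (blkFine L i.1.k (TGIndex.Mn d hL i.1)) (kingPrV L i.1.k i.1.m (TGIndex.Mn d hL i.1)) (fun μ => bshiftEquiv (TGIndex.Mn d hL i.1) (L ^ i.1.k) μ) (fun μ => bshiftEquiv (TGIndex.Mn d hL i.1) (L ^ i.1.m * L ^ i.1.k) μ) i.1.m (Nat.cast_ne_zero.mpr (NeZero.ne L)) C)
    (fun U => v1cfgFX 𝔄 ι e (fun μ => bshiftEquiv (TGIndex.Mn d hL i.1) (L ^ i.1.m * L ^ i.1.k) μ) ((unitTorusGeo L i.1.k (TGIndex.Mn d hL i.1)).eta * ((unitTorusGeo L i.1.k (TGIndex.Mn d hL i.1)).L ^ i.1.m)⁻¹) U.1) (fun U => v1cfgFX 𝔄 ι e (fun μ => bshiftEquiv (TGIndex.Mn d hL i.1) (L ^ i.1.k) μ) (unitTorusGeo L i.1.k (TGIndex.Mn d hL i.1)).eta U.2)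
    (fun μ => bshiftEquiv (TGIndex.Mn d hL i.1) (L ^ i.1.k) μ) (fun μ => bshiftEquiv (TGIndex.Mn d hL i.1) (L ^ i.1.m * L ^ i.1.k) μ) ((L ^ i.1.k : ℕ) : ℝ) ((L ^ i.1.m * L ^ i.1.k : ℕ) : ℝ) i.2
    (tensorId ι (gOp (TGIndex.Mn d hL i.1) (L ^ i.1.k) b))
    (tensorId ι (symbOp (TGIndex.Mn d hL i.1) (L ^ i.1.k) (sLap (TGIndex.Mn d hL i.1) (L ^ i.1.k) ((L ^ i.1.k : ℕ) : ℝ)) ∘ₗ gOp (TGIndex.Mn d hL i.1) (L ^ i.1.k) b))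
    (dPiecesM₂ d ι (TGIndex.Mn d hL i.1) (L ^ i.1.k) b)
    (tensorId ι (gOp (TGIndex.Mn d hL i.1) (L ^ i.1.m * L ^ i.1.k) b))
    (tensorId ι (symbOp (TGIndex.Mn d hL i.1) (L ^ i.1.m * L ^ i.1.k) (sLap (TGIndex.Mn d hL i.1) (L ^ i.1.m * L ^ i.1.k) ((L ^ i.1.m * L ^ i.1.k : ℕ) : ℝ)) ∘ₗ gOp (TGIndex.Mn d hL i.1) (L ^ i.1.m * L ^ i.1.k) b))
    (dPiecesM₂ d ι (TGIndex.Mn d hL i.1) (L ^ i.1.m * L ^ i.1.k) b)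

end Family

/-! ## §2 The fifteen letters for every regular pair in the window -/

section Letters

variable (d) (𝔄 : Type) [NormedRing 𝔄] [NormedAlgebra ℝ 𝔄] [CompleteSpace 𝔄] (ι : Type) [Fintype ι] [DecidableEq ι] [Nonempty ι] (e : 𝔄 ≃L[ℝ] (ι → ℝ))

omit [NeZero L] [Nonempty ι] in
/-- ★★ **THE FIFTEEN EXACT LETTERS FOR A REGULAR PAIR ON THE TORUS FAMILY**: for every index, every pair `U = (A′, B)` regular at `(c₃₅, α₀)` for the pair carrier (constant `C ≥ 0`)
and `c₃₅Mα₀` in the window `(2(1+|J|)(1+C))⁻¹`, the readings `v1cfgFX … U.1` (fine, `η′`) ∕ `v1cfgFX … U.2` (coarse, `η`) obey `TwoSidedLetters` at scale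
`14e(1+|J|)²(1+C)(κ_e+1)·c₃₅Mα₀` and rate `(L^k)^{−γ}` (`γ ≤ 1`) — FILE 29b ★★ `twoSidedLettersX_of_gauge` at `r̂ = (1+C)·c₃₅Mα₀`: the fine letters at `r ≤ r̂`, the comparison letters
`C·r·η ≤ r̂·θ` since `η = L^{−k} ≤ θ`; `η′ = η∕L^m ≤ η ≤ 1`. [cite: Balaban1985BackgroundPropagators, (3.35)–(3.36) p.396, (3.52) p.400 (shapes); King1986, p.664] -/
theorem twoSidedLettersXP_torus (hL : Odd L ∧ 1 < L) (hL2 : 2 ≤ L) {γ : ℝ} (hγle1 : γ ≤ 1) {c35 : ℝ} (hc35 : 0 < c35) {C : ℝ} (hC : 0 ≤ C) :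
    ∀ (i : TGIndex × Fin (d + 1)) (U : (Fin (d + 1) → (Tor (fine (L ^ i.1.m * L ^ i.1.k) (TGIndex.Mn d hL i.1)) × Fin (d + 1)) → 𝔄) × (Fin (d + 1) → (Tor (fine (L ^ i.1.k) (TGIndex.Mn d hL i.1)) × Fin (d + 1)) → 𝔄)) (α₀ : ℝ),
      (v1GaugeBgPair 𝔄 (Fin (d + 1)) (kingPrV L i.1.k i.1.m (TGIndex.Mn d hL i.1)) (fun μ => bshiftEquiv (TGIndex.Mn d hL i.1) (L ^ i.1.k) μ) (fun μ => bshiftEquiv (TGIndex.Mn d hL i.1) (L ^ i.1.m * L ^ i.1.k) μ) (unitTorusGeo L i.1.k (TGIndex.Mn d hL i.1)).eta ((unitTorusGeo L i.1.k (TGIndex.Mn d hL i.1)).eta * ((unitTorusGeo L i.1.k (TGIndex.Mn d hL i.1)).L ^ i.1.m)⁻¹) (unitTorusGeo L i.1.k (TGIndex.Mn d hL i.1)).M C).Reg335 c35 α₀ U → 0 < α₀ → 1 ≤ (unitTorusGeo L i.1.k (TGIndex.Mn d hL i.1)).M →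
      c35 * (unitTorusGeo L i.1.k (TGIndex.Mn d hL i.1)).M * α₀ ≤ (2 * ((1 + Fintype.card (Fin (d + 1))) * (1 + C)))⁻¹ →
      TwoSidedLetters (Fin (d + 1)) ι (kingPrV L i.1.k i.1.m (TGIndex.Mn d hL i.1)) (fun μ => bshiftEquiv (TGIndex.Mn d hL i.1) (L ^ i.1.k) μ) (fun μ => bshiftEquiv (TGIndex.Mn d hL i.1) (L ^ i.1.m * L ^ i.1.k) μ) ((L ^ i.1.k : ℕ) : ℝ) ((L ^ i.1.m * L ^ i.1.k : ℕ) : ℝ)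
        ((14 * Real.exp 1 * (1 + Fintype.card (Fin (d + 1))) * ((1 + Fintype.card (Fin (d + 1))) * (1 + C)) * (basisConst e + 1)) * (c35 * (unitTorusGeo L i.1.k (TGIndex.Mn d hL i.1)).M * α₀)) (((L : ℝ) ^ i.1.k) ^ (-γ))
        (v1cfgFX 𝔄 ι e (fun μ => bshiftEquiv (TGIndex.Mn d hL i.1) (L ^ i.1.m * L ^ i.1.k) μ) ((unitTorusGeo L i.1.k (TGIndex.Mn d hL i.1)).eta * ((unitTorusGeo L i.1.k (TGIndex.Mn d hL i.1)).L ^ i.1.m)⁻¹) U.1) (v1cfgFX 𝔄 ι e (fun μ => bshiftEquiv (TGIndex.Mn d hL i.1) (L ^ i.1.k) μ) (unitTorusGeo L i.1.k (TGIndex.Mn d hL i.1)).eta U.2) := by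
  have hL1 : 1 ≤ L := by omega
  have hLr : (0 : ℝ) < (L : ℝ) := by exact_mod_cast (show 0 < L by omega)
  have hLr1 : (1 : ℝ) ≤ (L : ℝ) := by exact_mod_cast hL1
  have hdJ0 : (0 : ℝ) ≤ Fintype.card (Fin (d + 1)) := Nat.cast_nonneg _
  have hκe := basisConst_nonneg e
  have hden : 0 < 2 * ((1 + Fintype.card (Fin (d + 1))) * (1 + C)) := by positivity
  intro i U α₀ hreg hα₀ hM hwin
  obtain ⟨⟨h1, h2, -⟩, hs, hdc, hf, hfT, hfD⟩ := hreg
  have hMeq : (unitTorusGeo L i.1.k (TGIndex.Mn d hL i.1)).M = 1 := rfl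
  have hηc : (unitTorusGeo L i.1.k (TGIndex.Mn d hL i.1)).eta = ((L : ℝ) ^ i.1.k)⁻¹ := rfl
  have hηf : ((unitTorusGeo L i.1.k (TGIndex.Mn d hL i.1)).eta * ((unitTorusGeo L i.1.k (TGIndex.Mn d hL i.1)).L ^ i.1.m)⁻¹) = ((L : ℝ) ^ i.1.k)⁻¹ * ((L : ℝ) ^ i.1.m)⁻¹ := rfl
  have hLk : (0 : ℝ) < (L : ℝ) ^ i.1.k := pow_pos hLr _
  have hLm : (1 : ℝ) ≤ (L : ℝ) ^ i.1.m := one_le_pow₀ hLr1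
  have hη' : 0 < ((unitTorusGeo L i.1.k (TGIndex.Mn d hL i.1)).eta * ((unitTorusGeo L i.1.k (TGIndex.Mn d hL i.1)).L ^ i.1.m)⁻¹) := by rw [hηf]; positivity
  have hη : 0 < (unitTorusGeo L i.1.k (TGIndex.Mn d hL i.1)).eta := by rw [hηc]; positivity
  have hη'η : ((unitTorusGeo L i.1.k (TGIndex.Mn d hL i.1)).eta * ((unitTorusGeo L i.1.k (TGIndex.Mn d hL i.1)).L ^ i.1.m)⁻¹) ≤ (unitTorusGeo L i.1.k (TGIndex.Mn d hL i.1)).eta := by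
    rw [hηf, hηc]; exact mul_le_of_le_one_right (inv_nonneg.mpr hLk.le) (inv_le_one_of_one_le₀ hLm)
  have hη1 : (unitTorusGeo L i.1.k (TGIndex.Mn d hL i.1)).eta ≤ 1 := by rw [hηc]; exact inv_le_one_of_one_le₀ (one_le_pow₀ hLr1)
  have hηθ : (unitTorusGeo L i.1.k (TGIndex.Mn d hL i.1)).eta ≤ ((L : ℝ) ^ i.1.k) ^ (-γ) := by rw [hηc]; exact inv_pow_le_rpow hL1 i.1.k hγle1
  have hθ0 : 0 ≤ ((L : ℝ) ^ i.1.k) ^ (-γ) := Real.rpow_nonneg hLk.le _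
  have hn : (unitTorusGeo L i.1.k (TGIndex.Mn d hL i.1)).eta⁻¹ = ((L ^ i.1.k : ℕ) : ℝ) := by rw [hηc, inv_inv]; push_cast; ring
  have hn' : (((unitTorusGeo L i.1.k (TGIndex.Mn d hL i.1)).eta * ((unitTorusGeo L i.1.k (TGIndex.Mn d hL i.1)).L ^ i.1.m)⁻¹))⁻¹ = ((L ^ i.1.m * L ^ i.1.k : ℕ) : ℝ) := by rw [hηf, mul_inv, inv_inv, inv_inv]; push_cast; ring
  -- the scale `r = c₃₅Mα₀`, the enlarged scale `r̂ = (1 + C) r` and the window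
  set r : ℝ := c35 * (unitTorusGeo L i.1.k (TGIndex.Mn d hL i.1)).M * α₀ with hrdef
  have hr0 : 0 ≤ r := by rw [hrdef, hMeq]; positivity
  set R : ℝ := (1 + C) * r with hRdef
  have hR0 : 0 ≤ R := by positivity
  have hrR : r ≤ R := by rw [hRdef]; nlinarith
  have hCR : C * r ≤ R := by rw [hRdef]; nlinarith
  have hCRη : C * r * (unitTorusGeo L i.1.k (TGIndex.Mn d hL i.1)).eta ≤ R * ((L : ℝ) ^ i.1.k) ^ (-γ) := mul_le_mul hCR hηθ hη.le hR0
  have hR2 : 2 * ((1 + Fintype.card (Fin (d + 1))) * R) ≤ 1 := by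
    calc 2 * ((1 + Fintype.card (Fin (d + 1))) * R) = (2 * ((1 + Fintype.card (Fin (d + 1))) * (1 + C))) * r := by rw [hRdef]; ring
      _ ≤ (2 * ((1 + Fintype.card (Fin (d + 1))) * (1 + C))) * (2 * ((1 + Fintype.card (Fin (d + 1))) * (1 + C)))⁻¹ := mul_le_mul_of_nonneg_left hwin hden.le
      _ = 1 := mul_inv_cancel₀ hden.ne'
  have key := twoSidedLettersX_of_gauge e (ι := ι) (π := (kingPrV L i.1.k i.1.m (TGIndex.Mn d hL i.1))) (s := (fun μ => bshiftEquiv (TGIndex.Mn d hL i.1) (L ^ i.1.k) μ)) (s' := (fun μ => bshiftEquiv (TGIndex.Mn d hL i.1) (L ^ i.1.m * L ^ i.1.k) μ)) hη' hη'η hη1 hηθ hR0 hR2 (A' := U.1) (A := U.2)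
    (fun μ x' => (h1 μ x').trans hrR) (fun μ x => (hs μ x).trans hCR)
    (fun μ x' => by simpa only [Equiv.apply_symm_apply] using (h2 μ μ (((fun μ => bshiftEquiv (TGIndex.Mn d hL i.1) (L ^ i.1.m * L ^ i.1.k) μ) μ).symm x')).trans (mul_le_mul_of_nonneg_right hrR hη'.le))
    (fun μ x => (hdc μ x).trans (mul_le_mul_of_nonneg_right hCR hη.le))
    (fun μ x' => (hf μ x').trans hCRη) (fun μ x' => (hfT μ x').trans hCRη) (fun μ x' => (hfD μ x').trans hCRη)
  rw [hn, hn'] at key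
  refine key.mono ?_ hθ0
  have hT : 0 ≤ 14 * Real.exp 1 * (1 + Fintype.card (Fin (d + 1))) * ((1 + Fintype.card (Fin (d + 1))) * (1 + C)) * r := by positivity
  calc 14 * Real.exp 1 * (1 + Fintype.card (Fin (d + 1))) * basisConst e * ((1 + Fintype.card (Fin (d + 1))) * R)
      = 14 * Real.exp 1 * (1 + Fintype.card (Fin (d + 1))) * ((1 + Fintype.card (Fin (d + 1))) * (1 + C)) * r * basisConst e := by rw [hRdef]; ring
    _ ≤ 14 * Real.exp 1 * (1 + Fintype.card (Fin (d + 1))) * ((1 + Fintype.card (Fin (d + 1))) * (1 + C)) * r * (basisConst e + 1) :=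
        mul_le_mul_of_nonneg_left (by linarith) hT
    _ = 14 * Real.exp 1 * (1 + Fintype.card (Fin (d + 1))) * ((1 + Fintype.card (Fin (d + 1))) * (1 + C)) * (basisConst e + 1) * r := by ring

end Letters

/-! ## §3 The node theorem over the pair carrier -/

section Node

variable (d) (𝔄 : Type) [NormedRing 𝔄] [NormedAlgebra ℝ 𝔄] [CompleteSpace 𝔄] (ι : Type) [Fintype ι] [DecidableEq ι] [Nonempty ι] (e : 𝔄 ≃L[ℝ] (ι → ℝ))

/-- ★★★ **`NE2PlusOperatorM1` FOR THE GAUGE-DRESSED PAIR OVER THE PAIR CARRIER, MODULO ONLY THE `U ≡ 1` ENTRY-2 η-DEFECT** — FILE 39's socket at the realised family with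
letters by §2 (FILE 39 §3's proof with the pair carrier, `(1 + C)` for `(3 + C₀)`). [cite: Balaban1985BackgroundPropagators, Thm 3.1 p.397; (3.35)–(3.36) p.396, (3.52) p.400; King1986, p.664] -/
theorem ne2PlusOperatorM1_fullGM₂_v1XP_of_entry2 (hLodd : Odd L) (hL2 : 2 ≤ L) (hL : Odd L ∧ 1 < L) {b : ℝ} (hb : 0 < b) (c35 : ℝ) (hc35 : 0 < c35) {C : ℝ} (hC : 0 ≤ C)
    {γ : ℝ} (hγ0 : 0 < γ) (hγ1 : γ ≤ 1 / 16) {B₂ δ₂ : ℝ} (hB₂ : 0 ≤ B₂) (hδ₂ : 0 < δ₂)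
    (h2 : ∀ (i : TGIndex) (ν : Fin (d + 1)),
      HasMaj (BlockNorm.ofBlocks (unitTorusGeo L i.k (TGIndex.Mn d hL i)) (blkFine L i.k (TGIndex.Mn d hL i)))
        (BlockNorm.ofBlocks (unitTorusGeo L i.k (TGIndex.Mn d hL i)) (blkFine L i.k (TGIndex.Mn d hL i) ∘ kingPrV L i.k i.m (TGIndex.Mn d hL i)))
        (idef (pull (kingPrV L i.k i.m (TGIndex.Mn d hL i))) (pull (kingPrV L i.k i.m (TGIndex.Mn d hL i)))
          (gOp (TGIndex.Mn d hL i) (L ^ i.m * L ^ i.k) b ∘ₗ fgradAdj ((L ^ i.m * L ^ i.k : ℕ) : ℝ) (bshiftEquiv (TGIndex.Mn d hL i) (L ^ i.m * L ^ i.k) ν))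
          (gOp (TGIndex.Mn d hL i) (L ^ i.k) b ∘ₗ fgradAdj ((L ^ i.k : ℕ) : ℝ) (bshiftEquiv (TGIndex.Mn d hL i) (L ^ i.k) ν)))
        (fun y y' => B₂ * ((L : ℝ) ^ i.k) ^ (-γ) * Real.exp (-(δ₂ * tdistT (TGIndex.Mn d hL i) y y')))) :
    NE2PlusOperatorM1 c35 (fgInstanceV1GP d 𝔄 ι hL C) (fgFamilyV1XP d 𝔄 ι e hL C b) := by
  obtain ⟨δ, β, m₀, cT, mT, hδ, hδδ₂, hβ, hm₀, hBm, hcT, hmT, H⟩ := uniform_layer_fullGM₂R d ι hLodd hL2 hL hb hγ0 hγ1 hδ₂ hB₂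
  have hL0 : L ≠ 0 := by omega
  have hL1 : 1 ≤ L := by omega
  have hLr : (0 : ℝ) < (L : ℝ) := by exact_mod_cast (show 0 < L by omega)
  have hLr1 : (1 : ℝ) ≤ (L : ℝ) := by exact_mod_cast hL1
  have hγle1 : γ ≤ 1 := by linarith
  have hσ : 0 < δ / 12 := by positivity
  have hdJ : (Fintype.card (Fin (d + 1)) : ℝ) = (d : ℝ) + 1 := by rw [Fintype.card_fin]; push_cast; ring
  have hdJ0 : (0 : ℝ) ≤ Fintype.card (Fin (d + 1)) := Nat.cast_nonneg _
  have hDS : ∀ (i : TGIndex × Fin (d + 1)) (ν : Fin (d + 1)),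
      HasMaj (BlockNorm.ofBlocks (unitTorusGeo L i.1.k (TGIndex.Mn d hL i.1)) (liftBlk (blkFine L i.1.k (TGIndex.Mn d hL i.1)) ι)) (BlockNorm.ofBlocks (unitTorusGeo L i.1.k (TGIndex.Mn d hL i.1)) (liftBlk (blkFine L i.1.k (TGIndex.Mn d hL i.1) ∘ kingPrV L i.1.k i.1.m (TGIndex.Mn d hL i.1)) ι))
        (idef (pull (liftMap (kingPrV L i.1.k i.1.m (TGIndex.Mn d hL i.1)) ι)) (pull (liftMap (kingPrV L i.1.k i.1.m (TGIndex.Mn d hL i.1)) ι))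
          (tensorId ι (gOp (TGIndex.Mn d hL i.1) (L ^ i.1.m * L ^ i.1.k) b) ∘ₗ fgradAdj ((L ^ i.1.m * L ^ i.1.k : ℕ) : ℝ) (liftEquiv (bshiftEquiv (TGIndex.Mn d hL i.1) (L ^ i.1.m * L ^ i.1.k) ν) ι))
          (tensorId ι (gOp (TGIndex.Mn d hL i.1) (L ^ i.1.k) b) ∘ₗ fgradAdj ((L ^ i.1.k : ℕ) : ℝ) (liftEquiv (bshiftEquiv (TGIndex.Mn d hL i.1) (L ^ i.1.k) ν) ι)))
        (fun y y' => m₀ * ((L : ℝ) ^ i.1.k) ^ (-γ) * Real.exp (-(δ * (unitTorusGeo L i.1.k (TGIndex.Mn d hL i.1)).dist y y'))) := fun i ν => by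
    rw [idef_comp_fgradAdj_liftEquiv]
    exact hasMaj_tensorId ι (fun _ _ => mul_nonneg (mul_nonneg hm₀.le (Real.rpow_nonneg (pow_nonneg hLr.le _) _)) (Real.exp_nonneg _))
      ((h2 i.1 ν).mono fun y y' => le_rate hB₂ hBm (one_le_pow₀ hLr1) le_rfl hδδ₂ (tdistT_nonneg _ _ _))
  -- the constants of the pair letters (`r̂ = (1 + C)·c₃₅Mα₀`)
  set κ' : ℝ := 14 * Real.exp 1 * (1 + Fintype.card (Fin (d + 1))) * ((1 + Fintype.card (Fin (d + 1))) * (1 + C)) * (basisConst e + 1) with hκ'def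
  have hκe := basisConst_nonneg e
  have hκ'pos : 0 < κ' := by positivity
  set r₀ : ℝ := (2 * ((1 + Fintype.card (Fin (d + 1))) * (1 + C)))⁻¹ with hr₀def
  have hden : 0 < 2 * ((1 + Fintype.card (Fin (d + 1))) * (1 + C)) := by positivity
  have hr₀ : 0 < r₀ := inv_pos.2 hden
  -- the fifteen letters at every index, for every regular gauge field in the window
  have hLT : ∀ (i : TGIndex × Fin (d + 1)) (A' : (Fin (d + 1) → Tor (fine (L ^ i.1.m * L ^ i.1.k) (TGIndex.Mn d hL i.1)) × Fin (d + 1) → 𝔄) ×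
      (Fin (d + 1) → Tor (fine (L ^ i.1.k) (TGIndex.Mn d hL i.1)) × Fin (d + 1) → 𝔄)) (α₀ : ℝ),
      (v1GaugeBgPair 𝔄 (Fin (d + 1)) (kingPrV L i.1.k i.1.m (TGIndex.Mn d hL i.1)) (fun μ => bshiftEquiv (TGIndex.Mn d hL i.1) (L ^ i.1.k) μ) (fun μ => bshiftEquiv (TGIndex.Mn d hL i.1) (L ^ i.1.m * L ^ i.1.k) μ) (unitTorusGeo L i.1.k (TGIndex.Mn d hL i.1)).eta ((unitTorusGeo L i.1.k (TGIndex.Mn d hL i.1)).eta * ((unitTorusGeo L i.1.k (TGIndex.Mn d hL i.1)).L ^ i.1.m)⁻¹) (unitTorusGeo L i.1.k (TGIndex.Mn d hL i.1)).M C).Reg335 c35 α₀ A' → 0 < α₀ → 1 ≤ (unitTorusGeo L i.1.k (TGIndex.Mn d hL i.1)).M →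
      c35 * (unitTorusGeo L i.1.k (TGIndex.Mn d hL i.1)).M * α₀ ≤ r₀ →
      TwoSidedLetters (Fin (d + 1)) ι (kingPrV L i.1.k i.1.m (TGIndex.Mn d hL i.1)) (fun μ => bshiftEquiv (TGIndex.Mn d hL i.1) (L ^ i.1.k) μ) (fun μ => bshiftEquiv (TGIndex.Mn d hL i.1) (L ^ i.1.m * L ^ i.1.k) μ) ((L ^ i.1.k : ℕ) : ℝ)
        ((L ^ i.1.m * L ^ i.1.k : ℕ) : ℝ) (κ' * (c35 * (unitTorusGeo L i.1.k (TGIndex.Mn d hL i.1)).M * α₀)) (((L : ℝ) ^ i.1.k) ^ (-γ))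
        (v1cfgFX 𝔄 ι e (fun μ => bshiftEquiv (TGIndex.Mn d hL i.1) (L ^ i.1.m * L ^ i.1.k) μ) ((unitTorusGeo L i.1.k (TGIndex.Mn d hL i.1)).eta * ((unitTorusGeo L i.1.k (TGIndex.Mn d hL i.1)).L ^ i.1.m)⁻¹) A'.1)
        (v1cfgFX 𝔄 ι e (fun μ => bshiftEquiv (TGIndex.Mn d hL i.1) (L ^ i.1.k) μ) (unitTorusGeo L i.1.k (TGIndex.Mn d hL i.1)).eta A'.2) :=
    fun i A' α₀ hreg hα₀ hM hwin => twoSidedLettersXP_torus d 𝔄 ι e hL hL2 hγle1 hc35 hC i A' α₀ hreg hα₀ hM hwin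
  refine ne2PlusOperatorM1_twoSided_of_letters (I := TGIndex × Fin (d + 1)) (J := Fin (d + 1)) (ι := ι) (fun i => (unitTorusGeo L i.1.k (TGIndex.Mn d hL i.1)))
    (fun i => Tor (fine (L ^ i.1.k) (TGIndex.Mn d hL i.1)) × Fin (d + 1)) (fun i => Tor (fine (L ^ i.1.m * L ^ i.1.k) (TGIndex.Mn d hL i.1)) × Fin (d + 1))
    (fun i => blkFine L i.1.k (TGIndex.Mn d hL i.1)) (fun i => kingPrV L i.1.k i.1.m (TGIndex.Mn d hL i.1)) (fun i μ => bshiftEquiv (TGIndex.Mn d hL i.1) (L ^ i.1.k) μ) (fun i μ => bshiftEquiv (TGIndex.Mn d hL i.1) (L ^ i.1.m * L ^ i.1.k) μ)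
    (fun i => ((L ^ i.1.k : ℕ) : ℝ)) (fun i => ((L ^ i.1.m * L ^ i.1.k : ℕ) : ℝ)) (fun i => i.1.m)
    (fun i => v1GaugeBg 𝔄 (Fin (d + 1)) (fun μ => bshiftEquiv (TGIndex.Mn d hL i.1) (L ^ i.1.k) μ) (unitTorusGeo L i.1.k (TGIndex.Mn d hL i.1)).eta (unitTorusGeo L i.1.k (TGIndex.Mn d hL i.1)).M)
    (fun i => v1GaugeBgPair 𝔄 (Fin (d + 1)) (kingPrV L i.1.k i.1.m (TGIndex.Mn d hL i.1)) (fun μ => bshiftEquiv (TGIndex.Mn d hL i.1) (L ^ i.1.k) μ) (fun μ => bshiftEquiv (TGIndex.Mn d hL i.1) (L ^ i.1.m * L ^ i.1.k) μ) (unitTorusGeo L i.1.k (TGIndex.Mn d hL i.1)).eta ((unitTorusGeo L i.1.k (TGIndex.Mn d hL i.1)).eta * ((unitTorusGeo L i.1.k (TGIndex.Mn d hL i.1)).L ^ i.1.m)⁻¹) (unitTorusGeo L i.1.k (TGIndex.Mn d hL i.1)).M C)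
    (fun i => v1GaugePairingP 𝔄 (Fin (d + 1)) ι (g := (unitTorusGeo L i.1.k (TGIndex.Mn d hL i.1))) (blkFine L i.1.k (TGIndex.Mn d hL i.1)) (kingPrV L i.1.k i.1.m (TGIndex.Mn d hL i.1)) (fun μ => bshiftEquiv (TGIndex.Mn d hL i.1) (L ^ i.1.k) μ)
      (fun μ => bshiftEquiv (TGIndex.Mn d hL i.1) (L ^ i.1.m * L ^ i.1.k) μ) i.1.m (Nat.cast_ne_zero.mpr (NeZero.ne L)) C)
    (fun i U => v1cfgFX 𝔄 ι e (fun μ => bshiftEquiv (TGIndex.Mn d hL i.1) (L ^ i.1.m * L ^ i.1.k) μ) ((unitTorusGeo L i.1.k (TGIndex.Mn d hL i.1)).eta * ((unitTorusGeo L i.1.k (TGIndex.Mn d hL i.1)).L ^ i.1.m)⁻¹) U.1)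
    (fun i U => v1cfgFX 𝔄 ι e (fun μ => bshiftEquiv (TGIndex.Mn d hL i.1) (L ^ i.1.k) μ) (unitTorusGeo L i.1.k (TGIndex.Mn d hL i.1)).eta U.2)
    (fun i => ((L : ℝ) ^ i.1.k) ^ (-γ)) (fun i => i.2)
    (fun i => tensorId ι (gOp (TGIndex.Mn d hL i.1) (L ^ i.1.k) b))
    (fun i => tensorId ι (symbOp (TGIndex.Mn d hL i.1) (L ^ i.1.k) (sLap (TGIndex.Mn d hL i.1) (L ^ i.1.k) ((L ^ i.1.k : ℕ) : ℝ)) ∘ₗ gOp (TGIndex.Mn d hL i.1) (L ^ i.1.k) b))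
    (fun i => dPiecesM₂ d ι (TGIndex.Mn d hL i.1) (L ^ i.1.k) b)
    (fun i => tensorId ι (gOp (TGIndex.Mn d hL i.1) (L ^ i.1.m * L ^ i.1.k) b))
    (fun i => tensorId ι (symbOp (TGIndex.Mn d hL i.1) (L ^ i.1.m * L ^ i.1.k) (sLap (TGIndex.Mn d hL i.1) (L ^ i.1.m * L ^ i.1.k) ((L ^ i.1.m * L ^ i.1.k : ℕ) : ℝ)) ∘ₗ gOp (TGIndex.Mn d hL i.1) (L ^ i.1.m * L ^ i.1.k) b))
    (fun i => dPiecesM₂ d ι (TGIndex.Mn d hL i.1) (L ^ i.1.m * L ^ i.1.k) b)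
    c35 κ' r₀ hc35 hκ'pos hr₀ (fun i => triangle254_unitTorusGeo L i.1.k (TGIndex.Mn d hL i.1)) (fun i a c => tdistT_nonneg _ _ _) (fun i y => tdistT_self _ y) hσ.le
    (B4Sect5Proof.latticeConst_nonneg (d + 1) hσ.le) (fun i => rowSum_unitTorusGeo L i.1.k (TGIndex.Mn d hL i.1) hσ)
    (fun i => inv_pos.mpr (pow_pos hLr _)) (fun i => hLr) (fun i y => (unitTorusGeo_len L i.1.k (TGIndex.Mn d hL i.1) hL0 y).symm.le) (fun i => show (1 : ℝ) ≤ 1 from le_rfl)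
    (by linarith) hβ.le hm₀.le hγ0 (fun i => Real.rpow_nonneg (pow_nonneg hLr.le _) _) (fun i y => le_rfl) hcT.le hmT.le
    (fun i => (H i).1) (fun i => (H i).2.1) (fun i => (H i).2.2.1) (fun i => (H i).2.2.2.1) (fun i => (H i).2.2.2.2.1) (fun i => (H i).2.2.2.2.2.1)
    (fun i => (H i).2.2.2.2.2.2.1) (fun i => (H i).2.2.2.2.2.2.2.1) (fun i => (H i).2.2.2.2.2.2.2.2.1) (fun i => (H i).2.2.2.2.2.2.2.2.2.1)
    (fun i ν => hDS i ν) (fun i => (H i).2.2.2.2.2.2.2.2.2.2.1) (fun i => (H i).2.2.2.2.2.2.2.2.2.2.2.1)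
    (fun i U α₀ hreg hα₀ hM hwin => hLT i U α₀ hreg hα₀ hM hwin) (fun i U α₀ hreg hα₀ hM hwin μ => ?_)
  -- the shift-defect row letter on the coarse forward coefficients: §2's generic conjunct with the letters 2 and 13 of the bundle
  obtain ⟨-, hA, -, -, -, -, -, -, -, -, -, -, hosc, -, -⟩ := hLT i U α₀ hreg hα₀ hM hwin
  exact (H i).2.2.2.2.2.2.2.2.2.2.2.2 (v1cfgFX 𝔄 ι e (fun μ => bshiftEquiv (TGIndex.Mn d hL i.1) (L ^ i.1.k) μ) (unitTorusGeo L i.1.k (TGIndex.Mn d hL i.1)).eta U.2).2 _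
    (mul_nonneg hκ'pos.le (mul_nonneg (mul_nonneg hc35.le (zero_le_one.trans hM)) hα₀.le)) (fun μ x i' => hA (Sum.inl μ) x i') hosc μ

/-- ★★★ **`NE2PlusOperatorM1`, HYPOTHESIS-FREE, FOR EVERY COMPARISON CONSTANT `C ≥ 0`: Bałaban's full `U ≡ 1` propagator ⊗ 1_𝔤 dressed by the EXACT species of a live fine field
`A′` (fine coefficients) and of ANY coarse representative `B` within the comparison letters (coarse coefficients)** — fed with dag-n15-a's ENTRY 2 (part 71) at `γ = 1∕(8(d+1))`.
[cite: Balaban1985BackgroundPropagators, Thm 3.1 p.397 (quantifier template); (3.35)–(3.36) p.396, (3.42) p.397, (3.52) p.400; Balaban1984PropagatorsI, Prop. 1.2 p.35; King1986, p.664] -/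
theorem ne2PlusOperatorM1_fullGM₂_v1XP (hd1 : 1 ≤ d) (hLodd : Odd L) (hL2 : 2 ≤ L) (hL : Odd L ∧ 1 < L) {b : ℝ} (hb : 0 < b) (c35 : ℝ) (hc35 : 0 < c35) {C : ℝ} (hC : 0 ≤ C) :
    NE2PlusOperatorM1 c35 (fgInstanceV1GP d 𝔄 ι hL C) (fgFamilyV1XP d 𝔄 ι e hL C b) := by
  obtain ⟨δ₂, B₂, hδ₂, hB₂, H2⟩ := hasMaj_twoGridDefect_div (d := d) hLodd hL2 hb
  have hd1' : (1 : ℝ) ≤ (d : ℝ) := by exact_mod_cast hd1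
  have hγ0 : 0 < 1 / (8 * ((d : ℝ) + 1)) := by positivity
  have hγ1 : 1 / (8 * ((d : ℝ) + 1)) ≤ 1 / 16 := one_div_le_one_div_of_le (by norm_num) (by nlinarith)
  refine ne2PlusOperatorM1_fullGM₂_v1XP_of_entry2 d 𝔄 ι e hLodd hL2 hL hb c35 hc35 hC hγ0 hγ1 hB₂.le hδ₂ fun i ν => ?_
  have h := H2 i.mT i.k i.m i.one_le hL ν
  rw [← symbOp_sTinv_sub_one_eq, ← symbOp_sTinv_sub_one_eq, blkFine_comp_kingPrV]
  refine h.mono fun y y' => le_of_eq ?_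
  rw [show ((L ^ i.k : ℕ) : ℝ) = (L : ℝ) ^ i.k by push_cast; ring]
  exact rfl

/-- The printed-template shape BY NAME (VACUOUS AS TYPED on this `M ≡ 1` family — ref-F FLAG-VACUITY-A1; the content is `ne2PlusOperatorM1_fullGM₂_v1XP`). [bookkeeping] -/
theorem ne2PlusOperator_fullGM₂_v1XP (hd1 : 1 ≤ d) (hLodd : Odd L) (hL2 : 2 ≤ L) (hL : Odd L ∧ 1 < L) {b : ℝ} (hb : 0 < b) (c35 : ℝ) (hc35 : 0 < c35) {C : ℝ} (hC : 0 ≤ C) :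
    NE2PlusOperator c35 (fgInstanceV1GP d 𝔄 ι hL C) (fgFamilyV1XP d 𝔄 ι e hL C b) :=
  (ne2PlusOperatorM1_fullGM₂_v1XP d 𝔄 ι e hd1 hLodd hL2 hL hb c35 hc35 hC).ne2PlusOperator

/-- `d + 1 = 4` (`γ = 1∕32`). [cite: Balaban1985BackgroundPropagators, Thm 3.1 p.397 (quantifier template)] -/
theorem ne2PlusOperatorM1_fullGM₂_v1XP_dim4 (hLodd : Odd L) (hL2 : 2 ≤ L) (hL : Odd L ∧ 1 < L) {b : ℝ} (hb : 0 < b) (c35 : ℝ) (hc35 : 0 < c35) {C : ℝ} (hC : 0 ≤ C) :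
    NE2PlusOperatorM1 c35 (fgInstanceV1GP 3 𝔄 ι hL C) (fgFamilyV1XP 3 𝔄 ι e hL C b) :=
  ne2PlusOperatorM1_fullGM₂_v1XP 3 𝔄 ι e (by norm_num) hLodd hL2 hL hb c35 hc35 hC

end Node

/-! ## §4 The linear block mean is an admissible coarse representative (`C = 2(d+2)`), and the pair family at `(A′, Ā)` reads FILE 30's family -/

section Mean

variable (d) (𝔄 : Type) [NormedRing 𝔄] [NormedAlgebra ℝ 𝔄] [CompleteSpace 𝔄] (ι : Type) [Fintype ι] [DecidableEq ι] (e : 𝔄 ≃L[ℝ] (ι → ℝ))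

omit [CompleteSpace 𝔄] [DecidableEq ι] in
/-- ★ **THE LINEAR MEAN IS ADMISSIBLE** (`C = 2(d+2)`, `c, α₀ ≥ 0`): FILE 26 ★★ `gaugeLetters_of_mean` with the torus discharges of FILES 27∕30 (`bshiftEquiv_comm`, `fibre_conn_kingPrV`,
`kingPrV_bshiftEquiv_pow`, `η = L^mη′`), `C_πη′ = 2(d+1)(L^m − 1)η′ ≤ 2(d+1)η`, `η′ ≤ η`. [cite: Balaban1985BackgroundPropagators, (3.35)–(3.36) p.396 (shapes); King1986, p.664] -/
theorem reg335_pair_of_mean (hL : Odd L ∧ 1 < L) (i : TGIndex × Fin (d + 1)) {c α₀ : ℝ} (hc : 0 ≤ c) (hα₀ : 0 ≤ α₀)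
    (A' : Fin (d + 1) → (Tor (fine (L ^ i.1.m * L ^ i.1.k) (TGIndex.Mn d hL i.1)) × Fin (d + 1)) → 𝔄)
    (hreg : (v1GaugeBg 𝔄 (Fin (d + 1)) (fun μ => bshiftEquiv (TGIndex.Mn d hL i.1) (L ^ i.1.m * L ^ i.1.k) μ) ((unitTorusGeo L i.1.k (TGIndex.Mn d hL i.1)).eta * ((unitTorusGeo L i.1.k (TGIndex.Mn d hL i.1)).L ^ i.1.m)⁻¹) (unitTorusGeo L i.1.k (TGIndex.Mn d hL i.1)).M).Reg335 c α₀ A') :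
    (v1GaugeBgPair 𝔄 (Fin (d + 1)) (kingPrV L i.1.k i.1.m (TGIndex.Mn d hL i.1)) (fun μ => bshiftEquiv (TGIndex.Mn d hL i.1) (L ^ i.1.k) μ) (fun μ => bshiftEquiv (TGIndex.Mn d hL i.1) (L ^ i.1.m * L ^ i.1.k) μ) (unitTorusGeo L i.1.k (TGIndex.Mn d hL i.1)).eta ((unitTorusGeo L i.1.k (TGIndex.Mn d hL i.1)).eta * ((unitTorusGeo L i.1.k (TGIndex.Mn d hL i.1)).L ^ i.1.m)⁻¹) (unitTorusGeo L i.1.k (TGIndex.Mn d hL i.1)).M (2 * ((d : ℝ) + 2))).Reg335 c α₀ (A', gavgM 𝔄 (Fin (d + 1)) (kingPrV L i.1.k i.1.m (TGIndex.Mn d hL i.1)) A') := by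
  have hL0 : L ≠ 0 := by omega
  have hL1 : 1 ≤ L := by omega
  have hLr : (0 : ℝ) < (L : ℝ) := by exact_mod_cast (show 0 < L by omega)
  have hLr1 : (1 : ℝ) ≤ (L : ℝ) := by exact_mod_cast hL1
  obtain ⟨h1, h2, h3⟩ := hreg
  have hMeq : (unitTorusGeo L i.1.k (TGIndex.Mn d hL i.1)).M = 1 := rfl
  have hηc : (unitTorusGeo L i.1.k (TGIndex.Mn d hL i.1)).eta = ((L : ℝ) ^ i.1.k)⁻¹ := rfl
  have hηf : ((unitTorusGeo L i.1.k (TGIndex.Mn d hL i.1)).eta * ((unitTorusGeo L i.1.k (TGIndex.Mn d hL i.1)).L ^ i.1.m)⁻¹) = ((L : ℝ) ^ i.1.k)⁻¹ * ((L : ℝ) ^ i.1.m)⁻¹ := rfl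
  have hLk : (0 : ℝ) < (L : ℝ) ^ i.1.k := pow_pos hLr _
  have hLm : (0 : ℝ) < (L : ℝ) ^ i.1.m := pow_pos hLr _
  have hLm1 : (1 : ℝ) ≤ (L : ℝ) ^ i.1.m := one_le_pow₀ hLr1
  have hη' : 0 < ((unitTorusGeo L i.1.k (TGIndex.Mn d hL i.1)).eta * ((unitTorusGeo L i.1.k (TGIndex.Mn d hL i.1)).L ^ i.1.m)⁻¹) := by rw [hηf]; positivity
  have hη : 0 < (unitTorusGeo L i.1.k (TGIndex.Mn d hL i.1)).eta := by rw [hηc]; positivity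
  have hη'η : ((unitTorusGeo L i.1.k (TGIndex.Mn d hL i.1)).eta * ((unitTorusGeo L i.1.k (TGIndex.Mn d hL i.1)).L ^ i.1.m)⁻¹) ≤ (unitTorusGeo L i.1.k (TGIndex.Mn d hL i.1)).eta := by
    rw [hηf, hηc]; exact mul_le_of_le_one_right (inv_nonneg.mpr hLk.le) (inv_le_one_of_one_le₀ hLm1)
  have hN : (unitTorusGeo L i.1.k (TGIndex.Mn d hL i.1)).eta = ((L ^ i.1.m : ℕ) : ℝ) * ((unitTorusGeo L i.1.k (TGIndex.Mn d hL i.1)).eta * ((unitTorusGeo L i.1.k (TGIndex.Mn d hL i.1)).L ^ i.1.m)⁻¹) := by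
    rw [hηf, hηc]; push_cast; field_simp
  set r : ℝ := c * (unitTorusGeo L i.1.k (TGIndex.Mn d hL i.1)).M * α₀ with hrdef
  have hr0 : 0 ≤ r := by rw [hrdef, hMeq]; positivity
  -- `C_π·η′ ≤ 2(d+1)·η`
  have hCπ : ((2 * ((d + 1) * (L ^ i.1.m - 1)) : ℕ) : ℝ) * ((unitTorusGeo L i.1.k (TGIndex.Mn d hL i.1)).eta * ((unitTorusGeo L i.1.k (TGIndex.Mn d hL i.1)).L ^ i.1.m)⁻¹) ≤ 2 * ((d : ℝ) + 1) * (unitTorusGeo L i.1.k (TGIndex.Mn d hL i.1)).eta := by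
    have hsub : (((L ^ i.1.m - 1 : ℕ)) : ℝ) ≤ (L : ℝ) ^ i.1.m := by
      have h1' : 1 ≤ L ^ i.1.m := Nat.one_le_pow _ _ (by omega)
      rw [Nat.cast_sub h1']; push_cast; linarith
    have hcast : ((2 * ((d + 1) * (L ^ i.1.m - 1)) : ℕ) : ℝ) = 2 * ((d : ℝ) + 1) * (((L ^ i.1.m - 1 : ℕ)) : ℝ) := by push_cast; ring
    rw [hηf, hcast, hηc]
    calc 2 * ((d : ℝ) + 1) * (((L ^ i.1.m - 1 : ℕ)) : ℝ) * (((L : ℝ) ^ i.1.k)⁻¹ * ((L : ℝ) ^ i.1.m)⁻¹)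
        ≤ 2 * ((d : ℝ) + 1) * (L : ℝ) ^ i.1.m * (((L : ℝ) ^ i.1.k)⁻¹ * ((L : ℝ) ^ i.1.m)⁻¹) :=
          mul_le_mul_of_nonneg_right (mul_le_mul_of_nonneg_left hsub (by positivity)) (by positivity)
      _ = 2 * ((d : ℝ) + 1) * ((L : ℝ) ^ i.1.k)⁻¹ := by field_simp
  have key := gaugeLetters_of_mean (𝔄 := 𝔄) (J := Fin (d + 1)) (π := (kingPrV L i.1.k i.1.m (TGIndex.Mn d hL i.1))) (s := (fun μ => bshiftEquiv (TGIndex.Mn d hL i.1) (L ^ i.1.k) μ)) (s' := (fun μ => bshiftEquiv (TGIndex.Mn d hL i.1) (L ^ i.1.m * L ^ i.1.k) μ))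
    (fun μ κ x => bshiftEquiv_comm (TGIndex.Mn d hL i.1) (L ^ i.1.m * L ^ i.1.k) μ κ x)
    (fun f β hf => fibre_conn_kingPrV L i.1.k i.1.m (TGIndex.Mn d hL i.1) f β hf) (fun μ x' => kingPrV_bshiftEquiv_pow L i.1.k i.1.m (TGIndex.Mn d hL i.1) μ x') hη' hN hη hr0 h1 h2 h3
  obtain ⟨ks, -, kd, kf, kfT, kfD⟩ := key
  have hCr : r ≤ 2 * ((d : ℝ) + 2) * r := by nlinarith
  have hfit : ((2 * ((d + 1) * (L ^ i.1.m - 1)) : ℕ) : ℝ) * (r * ((unitTorusGeo L i.1.k (TGIndex.Mn d hL i.1)).eta * ((unitTorusGeo L i.1.k (TGIndex.Mn d hL i.1)).L ^ i.1.m)⁻¹)) ≤ 2 * ((d : ℝ) + 1) * r * (unitTorusGeo L i.1.k (TGIndex.Mn d hL i.1)).eta := by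
    calc ((2 * ((d + 1) * (L ^ i.1.m - 1)) : ℕ) : ℝ) * (r * ((unitTorusGeo L i.1.k (TGIndex.Mn d hL i.1)).eta * ((unitTorusGeo L i.1.k (TGIndex.Mn d hL i.1)).L ^ i.1.m)⁻¹)) = r * ((((2 * ((d + 1) * (L ^ i.1.m - 1)) : ℕ) : ℝ)) * ((unitTorusGeo L i.1.k (TGIndex.Mn d hL i.1)).eta * ((unitTorusGeo L i.1.k (TGIndex.Mn d hL i.1)).L ^ i.1.m)⁻¹)) := by ring
      _ ≤ r * (2 * ((d : ℝ) + 1) * (unitTorusGeo L i.1.k (TGIndex.Mn d hL i.1)).eta) := mul_le_mul_of_nonneg_left hCπ hr0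
      _ = 2 * ((d : ℝ) + 1) * r * (unitTorusGeo L i.1.k (TGIndex.Mn d hL i.1)).eta := by ring
  have hrη' : r * ((unitTorusGeo L i.1.k (TGIndex.Mn d hL i.1)).eta * ((unitTorusGeo L i.1.k (TGIndex.Mn d hL i.1)).L ^ i.1.m)⁻¹) ≤ r * (unitTorusGeo L i.1.k (TGIndex.Mn d hL i.1)).eta := mul_le_mul_of_nonneg_left hη'η hr0
  refine ⟨⟨h1, h2, h3⟩, fun μ x => (ks μ x).trans hCr, fun μ x => (kd μ x).trans (by nlinarith [mul_nonneg hr0 hη.le]), fun μ x' => (kf μ x').trans ?_,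
    fun μ x' => (kfT μ x').trans ?_, fun μ x' => (kfD μ x').trans ?_⟩
  · nlinarith [mul_nonneg hr0 hη.le]
  · nlinarith [mul_nonneg hr0 hη.le]
  · nlinarith [mul_nonneg hr0 hη.le]

omit [CompleteSpace 𝔄] in
/-- **THE PAIR FAMILY AT `(A′, Ā)` READS FILE 30's FAMILY AT `A′`**: the (3.42) entries of `fgFamilyV1XP … C b i` at the configuration `(A′, gavgM pr_V A′)` ARE those of `fgFamilyV1X … b i`
at `A′` (FILE 30's coarse reading `v1cfgCX` IS `v1cfgFX` of the linear mean; `rfl`). [bookkeeping] -/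
theorem fgFamilyV1XP_e_mean (hL : Odd L ∧ 1 < L) (C b : ℝ) (i : TGIndex × Fin (d + 1)) (A' : Fin (d + 1) → (Tor (fine (L ^ i.1.m * L ^ i.1.k) (TGIndex.Mn d hL i.1)) × Fin (d + 1)) → 𝔄) (n : Fin 4) :
    (fgFamilyV1XP d 𝔄 ι e hL C b i).e n (A', gavgM 𝔄 (Fin (d + 1)) (kingPrV L i.1.k i.1.m (TGIndex.Mn d hL i.1)) A') = (fgFamilyV1X d 𝔄 ι e hL b i).e n A' := rfl

omit [CompleteSpace 𝔄] in
/-- **CONSISTENCY: THE PAIR THEOREM AT `C = 2(d+2)` GIVES BACK FILE 39's THEOREM** (`c₃₅ ≥ 0`): restrict to the admissible pairs `(A′, Ā)` (`reg335_pair_of_mean`) and read the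
entries through `fgFamilyV1XP_e_mean`. [bookkeeping] -/
theorem ne2PlusOperatorM1_fullGM₂_v1X_of_pair (hL : Odd L ∧ 1 < L) {b c35 : ℝ} (hc35 : 0 ≤ c35)
    (h : NE2PlusOperatorM1 c35 (fgInstanceV1GP d 𝔄 ι hL (2 * ((d : ℝ) + 2))) (fgFamilyV1XP d 𝔄 ι e hL (2 * ((d : ℝ) + 2)) b)) :
    NE2PlusOperatorM1 c35 (fgInstanceV1G d 𝔄 ι hL) (fgFamilyV1X d 𝔄 ι e hL b) := by
  obtain ⟨δ₀, a₀, B₀, γ, hδ₀, ha₀, hB₀, hγ, H⟩ := h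
  exact ⟨δ₀, a₀, B₀, γ, hδ₀, ha₀, hB₀, hγ, fun i α₀ hα₀ hαa A' hA =>
    H i α₀ hα₀ hαa (A', gavgM 𝔄 (Fin (d + 1)) (kingPrV L i.1.k i.1.m (TGIndex.Mn d hL i.1)) A') (reg335_pair_of_mean d 𝔄 hL i hc35 hα₀.le A' hA)⟩

end Mean

end Summit.QuantumFields.YangMills.BalabanUVNodes.N15.BackgroundLayer
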